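import Literature.MathematicalPhysics.QuantumFieldTheory.PlaquetteWeightPolymerExpansion
import HarnessLib

/-!
# Twist locality for a general `SU(2)` plaquette weight: the centre flux is invisible to polymers with fewer than
# `L²` plaquettes

Topic `Literature/MathematicalPhysics/QuantumFieldTheory`; vocabulary of `PlaquetteWeightPolymers.lean` (`weightActivity`,
`weightPolymerActivity`, `centreEven`, `centreOdd`), `CharacterActionPolymers.lean` (`sheetAt`), `VortexTwistCohomology.lean`
(`flipLinks`, `coboundary`) and `CharacterExpansionTwistLocality.lean` (`coboundary_jShiftLinks`, `sq_le_card_of_odd_inter_sheetAt`).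
THEOREMS ONLY: the file `CharacterExpansionTwistLocality.lean` redone for an arbitrary measurable weight `w` with `sup|w - 1| ≤ ε`,
the integer/half-integer split `S¹`/`S^{1/2}` being replaced by the even/odd parts `w_±` of `w` under the centre `{±𝟙}`
(E. T. Tomboulis, arXiv:0707.2179 [Tomboulis2007Confinement] §6.2, text after (6.9), and (6.11); G. Münster, Nucl. Phys.
B180 (1981) 23 §3).

* `prod_weightActivity_eq_sum_sectors`, `integral_prod_weightActivity_eq_sum_sectors` — sector expansion;
* `weightSectorIntegrand_flipLinks`, `integral_weightSector_eq_zero_of_odd` — support rule (`U_b ↦ -U_b`);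
* `weightPolymerActivity_sheetAt_eq_of_card_lt`, `weightPolymerActivity_vortexSheet_eq_of_card_lt` — twist locality:
  `z^{(𝒱)}(X) = z(X)` for `|X| < L²`.

HONEST FRAMING: finite-volume algebra; nothing about (5.15)/(5.16), limits or confinement.
-/

noncomputable section

open MeasureTheory Finset
open scoped BigOperators symmDiff
open Literature.MathematicalPhysics.QuantumLattice
open Literature.Probability.LatticeModels (IsRConnected GeomInc Touches)

namespace Literature.MathematicalPhysics.QuantumFieldTheory

namespace Tomboulis2007

variable {d L : ℕ}

/-! ## Generic weight — twist locality -/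

section WeightTwistLocality

open Literature.Probability.LatticeModels

/-- `∏_{p∈Q} (± 1) = (-1)^{|Q ∩ V|}` (plumbing). [folklore] -/
private theorem prod_sign_eq_pow' (V Q : Finset (Plaquette d L)) :
    ∏ p ∈ Q, (if p ∈ V then (-1 : ℝ) else 1) = (-1 : ℝ) ^ (Q ∩ V).card := by
  rw [Finset.prod_ite, Finset.prod_const_one, mul_one, Finset.prod_const, Finset.filter_mem_eq_inter]

/-- **Sector expansion of the polymer integrand of a general weight**:
`∏_{p∈X} (w^{(V)}(U_p) - 1) = Σ_{Q⊆X} (-1)^{|Q∩V|} ∏_{p∈Q} w_-(U_p) ∏_{p∈X∖Q} (w_+(U_p) - 1)`.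
[cite: Tomboulis2007Confinement, App. A §5 eq. (A.17)] -/
theorem prod_weightActivity_eq_sum_sectors (w : SU2 → ℝ) (V X : Finset (Plaquette d L)) (U : GaugeConfig d L SU2) :
    ∏ p ∈ X, weightActivity w V U p =
      ∑ Q ∈ X.powerset, (-1 : ℝ) ^ (Q ∩ V).card *
        ((∏ p ∈ Q, centreOdd w (plaquetteHolonomy U p.1 p.2.1.1 p.2.1.2)) *
          ∏ p ∈ X \ Q, (centreEven w (plaquetteHolonomy U p.1 p.2.1.1 p.2.1.2) - 1)) := by
  simp_rw [weightActivity_eq_centreEven_add_sign_mul_centreOdd w V U]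
  rw [Finset.prod_add]
  refine Finset.sum_congr rfl fun Q _ => ?_
  rw [Finset.prod_mul_distrib, prod_sign_eq_pow']
  ring

/-- `σ_E(e) = (-𝟙)^{𝟙_E(e)}` (plumbing). [folklore] -/
private theorem linkSign_eq_negOne_pow' (E : Finset (Edge d L)) (e : Edge d L) :
    linkSign E e = negOne ^ linkInd E e := by
  unfold linkSign linkInd
  split_ifs <;> simp

/-- The plaquette sign is `(-𝟙)^{k_p(E)}` (plumbing). [folklore] -/
private theorem plaqSign_eq_negOne_pow' (E : Finset (Edge d L)) (x : Site d L) (i j : Fin d) :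
    plaqSign E x i j = negOne ^ flipCount E x i j := by
  simp only [plaqSign, flipCount, linkSign_eq_negOne_pow', pow_add]

variable [NeZero L]

/-- **Flipping the links of `E` signs the sector integrand by `(-1)^{|Q ∩ δE|}`** (`w_-` is odd, `w_+` even under the
centre). [cite: Tomboulis2007Confinement, §6.2 (text after eq. (6.9))] -/
theorem weightSectorIntegrand_flipLinks (w : SU2 → ℝ) (E : Finset (Edge d L)) (X Q : Finset (Plaquette d L))
    (U : GaugeConfig d L SU2) :
    (∏ p ∈ Q, centreOdd w (plaquetteHolonomy (flipLinks E U) p.1 p.2.1.1 p.2.1.2)) *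
        ∏ p ∈ X \ Q, (centreEven w (plaquetteHolonomy (flipLinks E U) p.1 p.2.1.1 p.2.1.2) - 1) =
      (-1 : ℝ) ^ (Q ∩ coboundary E).card *
        ((∏ p ∈ Q, centreOdd w (plaquetteHolonomy U p.1 p.2.1.1 p.2.1.2)) *
          ∏ p ∈ X \ Q, (centreEven w (plaquetteHolonomy U p.1 p.2.1.1 p.2.1.2) - 1)) := by
  have hH : ∀ p ∈ Q, centreOdd w (plaquetteHolonomy (flipLinks E U) p.1 p.2.1.1 p.2.1.2) =
      (if p ∈ coboundary E then (-1 : ℝ) else 1) * centreOdd w (plaquetteHolonomy U p.1 p.2.1.1 p.2.1.2) := by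
    intro p _
    rw [plaquetteHolonomy_flipLinks, plaqSign_eq_negOne_pow', centreOdd_negOne_pow_mul]
    by_cases h : p ∈ coboundary E
    · rw [if_pos h, ((mem_coboundary E p).mp h).neg_one_pow]
    · rw [if_neg h, (Nat.not_odd_iff_even.mp (fun h' => h ((mem_coboundary E p).mpr h'))).neg_one_pow]
  have hI : ∀ p ∈ X \ Q, centreEven w (plaquetteHolonomy (flipLinks E U) p.1 p.2.1.1 p.2.1.2) - 1 =
      centreEven w (plaquetteHolonomy U p.1 p.2.1.1 p.2.1.2) - 1 := by
    intro p _
    rw [plaquetteHolonomy_flipLinks, plaqSign_eq_negOne_pow', centreEven_negOne_pow_mul]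
  rw [Finset.prod_congr rfl hH, Finset.prod_congr rfl hI, Finset.prod_mul_distrib, prod_sign_eq_pow']
  ring

/-- **Support rule**: a sector `Q` meeting some coboundary oddly integrates to zero.
[cite: Tomboulis2007Confinement, §6.2 (text after eq. (6.9))] -/
theorem integral_weightSector_eq_zero_of_odd (w : SU2 → ℝ) {E : Finset (Edge d L)} {X Q : Finset (Plaquette d L)}
    (hodd : Odd (Q ∩ coboundary E).card) :
    ∫ U, (∏ p ∈ Q, centreOdd w (plaquetteHolonomy U p.1 p.2.1.1 p.2.1.2)) *
        ∏ p ∈ X \ Q, (centreEven w (plaquetteHolonomy U p.1 p.2.1.1 p.2.1.2) - 1)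
      ∂(Measure.pi fun _ : Edge d L => haarProbability SU2) = 0 := by
  have key : ∀ F : GaugeConfig d L SU2 → ℝ, (∀ U, F (flipLinks E U) = -1 * F U) →
      ∫ U, F U ∂(Measure.pi fun _ : Edge d L => haarProbability SU2) = 0 := by
    intro F hF
    have hmp : MeasurePreserving (flipEquiv E)
        (Measure.pi fun _ : Edge d L => haarProbability SU2)
        (Measure.pi fun _ : Edge d L => haarProbability SU2) :=
      measurePreserving_flipLinks E
    have h1 : ∫ U, F U ∂(Measure.pi fun _ : Edge d L => haarProbability SU2) =
        -1 * ∫ U, F U ∂(Measure.pi fun _ : Edge d L => haarProbability SU2) := by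
      calc ∫ U, F U ∂(Measure.pi fun _ : Edge d L => haarProbability SU2)
          = ∫ U, F (flipLinks E U) ∂(Measure.pi fun _ : Edge d L => haarProbability SU2) :=
            (hmp.integral_comp' F).symm
        _ = ∫ U, -1 * F U ∂(Measure.pi fun _ : Edge d L => haarProbability SU2) := by
            congr 1
            funext U
            exact hF U
        _ = -1 * ∫ U, F U ∂(Measure.pi fun _ : Edge d L => haarProbability SU2) := integral_const_mul _ _
    linarith
  refine key _ fun U => ?_
  rw [weightSectorIntegrand_flipLinks w E X Q U, hodd.neg_one_pow]

/-- Contrapositive: a sector with non-zero integral meets every coboundary evenly.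
[cite: Tomboulis2007Confinement, §6.2 (text after eq. (6.9))] -/
theorem even_inter_coboundary_of_integral_weightSector_ne_zero (w : SU2 → ℝ) {X Q : Finset (Plaquette d L)}
    (hne : ∫ U, (∏ p ∈ Q, centreOdd w (plaquetteHolonomy U p.1 p.2.1.1 p.2.1.2)) *
        ∏ p ∈ X \ Q, (centreEven w (plaquetteHolonomy U p.1 p.2.1.1 p.2.1.2) - 1)
      ∂(Measure.pi fun _ : Edge d L => haarProbability SU2) ≠ 0)
    (E : Finset (Edge d L)) : Even (Q ∩ coboundary E).card := by
  by_contra h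
  exact hne (integral_weightSector_eq_zero_of_odd w (Nat.not_even_iff_odd.mp h))

omit [NeZero L] in
/-- Plaquette holonomies are measurable (plumbing). [folklore] -/
private theorem measurable_hol' (p : Plaquette d L) :
    Measurable fun U : GaugeConfig d L SU2 => plaquetteHolonomy U p.1 p.2.1.1 p.2.1.2 := by
  haveI : SecondCountableTopology SU2 := secondCountableTopology_su2
  unfold plaquetteHolonomy
  fun_prop

omit [NeZero L] in
/-- `|w_-(W)| ≤ ε` when `sup|w - 1| ≤ ε` (plumbing). [folklore] -/
private theorem abs_centreOdd_le {w : SU2 → ℝ} {ε : ℝ} (hε : ∀ W, |w W - 1| ≤ ε) (W : SU2) : |centreOdd w W| ≤ ε := by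
  unfold centreOdd
  have h1 := hε W
  have h2 := hε (negOne * W)
  rw [abs_le] at h1 h2 ⊢
  constructor <;> linarith [h1.1, h1.2, h2.1, h2.2]

omit [NeZero L] in
/-- `|w_+(W) - 1| ≤ ε` when `sup|w - 1| ≤ ε` (plumbing). [folklore] -/
private theorem abs_centreEven_sub_one_le {w : SU2 → ℝ} {ε : ℝ} (hε : ∀ W, |w W - 1| ≤ ε) (W : SU2) :
    |centreEven w W - 1| ≤ ε := by
  unfold centreEven
  have h1 := hε W
  have h2 := hε (negOne * W)
  rw [abs_le] at h1 h2 ⊢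
  constructor <;> linarith [h1.1, h1.2, h2.1, h2.2]

/-- Integrability of the sector integrands (bounded measurable; plumbing). [folklore] -/
private theorem integrable_weightSector {w : SU2 → ℝ} (hw : Measurable w) {ε : ℝ} (hε : ∀ W, |w W - 1| ≤ ε)
    (X Q : Finset (Plaquette d L)) :
    Integrable (fun U : GaugeConfig d L SU2 =>
        (∏ p ∈ Q, centreOdd w (plaquetteHolonomy U p.1 p.2.1.1 p.2.1.2)) *
          ∏ p ∈ X \ Q, (centreEven w (plaquetteHolonomy U p.1 p.2.1.1 p.2.1.2) - 1))
      (Measure.pi fun _ : Edge d L => haarProbability SU2) := by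
  haveI : SecondCountableTopology SU2 := secondCountableTopology_su2
  have hmO : Measurable (centreOdd w) := by
    unfold centreOdd
    exact (hw.sub (hw.comp (measurable_const.mul measurable_id))).div_const 2
  have hmE : Measurable (centreEven w) := by
    unfold centreEven
    exact (hw.add (hw.comp (measurable_const.mul measurable_id))).div_const 2
  have hm : Measurable fun U : GaugeConfig d L SU2 =>
      (∏ p ∈ Q, centreOdd w (plaquetteHolonomy U p.1 p.2.1.1 p.2.1.2)) *
        ∏ p ∈ X \ Q, (centreEven w (plaquetteHolonomy U p.1 p.2.1.1 p.2.1.2) - 1) :=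
    (Finset.measurable_prod _ fun p _ => hmO.comp (measurable_hol' p)).mul
      (Finset.measurable_prod _ fun p _ => (hmE.comp (measurable_hol' p)).sub measurable_const)
  refine Integrable.of_mem_Icc (-(ε ^ Q.card * ε ^ (X \ Q).card)) (ε ^ Q.card * ε ^ (X \ Q).card) hm.aemeasurable
    (ae_of_all _ fun U => Set.mem_Icc.2 (abs_le.1 ?_))
  rw [abs_mul, Finset.abs_prod, Finset.abs_prod]
  refine mul_le_mul ?_ ?_ (Finset.prod_nonneg fun p _ => abs_nonneg _) (pow_nonneg ((abs_nonneg _).trans (hε 1)) _)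
  · rw [← Finset.prod_const]
    exact Finset.prod_le_prod (fun p _ => abs_nonneg _) fun p _ => abs_centreOdd_le hε _
  · rw [← Finset.prod_const]
    exact Finset.prod_le_prod (fun p _ => abs_nonneg _) fun p _ => abs_centreEven_sub_one_le hε _

/-- **The integral of the polymer integrand as a signed sum of sector integrals** (general weight).
[cite: Tomboulis2007Confinement, App. A §5 eqs. (A.17)–(A.18)] -/
theorem integral_prod_weightActivity_eq_sum_sectors {w : SU2 → ℝ} (hw : Measurable w) {ε : ℝ}
    (hε : ∀ W, |w W - 1| ≤ ε) (V X : Finset (Plaquette d L)) :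
    ∫ U, ∏ p ∈ X, weightActivity w V U p ∂(Measure.pi fun _ : Edge d L => haarProbability SU2) =
      ∑ Q ∈ X.powerset, (-1 : ℝ) ^ (Q ∩ V).card *
        ∫ U, (∏ p ∈ Q, centreOdd w (plaquetteHolonomy U p.1 p.2.1.1 p.2.1.2)) *
          ∏ p ∈ X \ Q, (centreEven w (plaquetteHolonomy U p.1 p.2.1.1 p.2.1.2) - 1)
          ∂(Measure.pi fun _ : Edge d L => haarProbability SU2) := by
  simp_rw [prod_weightActivity_eq_sum_sectors w V X]
  rw [integral_finsetSum _ (fun Q _ => (integrable_weightSector hw hε X Q).const_mul _)]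
  refine Finset.sum_congr rfl fun Q _ => ?_
  rw [integral_const_mul]

/-- **Twist locality for a general weight**: for every plaquette set `X` with fewer than `L²` plaquettes and every
parallel sheet `𝒱_{a,b}`, `z^{(𝒱_{a,b})}(X) = z(X)` (arXiv:0707.2179 §6.2 after (6.9) and (6.11)).
[cite: Tomboulis2007Confinement, §6.2 eqs. (6.10)–(6.11)] -/
theorem weightPolymerActivity_sheetAt_eq_of_card_lt {w : SU2 → ℝ} (hw : Measurable w) {ε : ℝ}
    (hε : ∀ W, |w W - 1| ≤ ε) {i j : Fin d} (hij : i < j) (a b : ZMod L) {X : Finset (Plaquette d L)}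
    (hX : X.card < L ^ 2) :
    weightPolymerActivity w (sheetAt L a b i j hij) X = weightPolymerActivity w ∅ X := by
  by_cases hconn : IsRConnected linkRel X
  · rw [weightPolymerActivity_of_isRConnected hconn, weightPolymerActivity_of_isRConnected hconn,
      integral_prod_weightActivity_eq_sum_sectors hw hε, integral_prod_weightActivity_eq_sum_sectors hw hε]
    congr 1
    refine Finset.sum_congr rfl fun Q hQ => ?_
    rw [Finset.inter_empty, Finset.card_empty, pow_zero]
    by_cases hz : ∫ U, (∏ p ∈ Q, centreOdd w (plaquetteHolonomy U p.1 p.2.1.1 p.2.1.2)) *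
        ∏ p ∈ X \ Q, (centreEven w (plaquetteHolonomy U p.1 p.2.1.1 p.2.1.2) - 1)
        ∂(Measure.pi fun _ : Edge d L => haarProbability SU2) = 0
    · rw [hz, mul_zero, mul_zero]
    · have hcyc := even_inter_coboundary_of_integral_weightSector_ne_zero w hz
      have heven : Even (Q ∩ sheetAt L a b i j hij).card := by
        by_contra hodd
        have hL := sq_le_card_of_odd_inter_sheetAt hcyc hij (Nat.not_even_iff_odd.mp hodd)
        have hQX : Q.card ≤ X.card := Finset.card_le_card (Finset.mem_powerset.1 hQ)
        omega
      rw [heven.neg_one_pow]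
  · rw [weightPolymerActivity_of_not_isRConnected hconn, weightPolymerActivity_of_not_isRConnected hconn]

/-- **Twist locality for the sheet `𝒱_{ij}`**: `z⁻(X) = z(X)` whenever `|X| < L²` (general weight).
[cite: Tomboulis2007Confinement, §6.2 eqs. (6.10)–(6.11)] -/
theorem weightPolymerActivity_vortexSheet_eq_of_card_lt {w : SU2 → ℝ} (hw : Measurable w) {ε : ℝ}
    (hε : ∀ W, |w W - 1| ≤ ε) {i j : Fin d} (hij : i < j) {X : Finset (Plaquette d L)} (hX : X.card < L ^ 2) :
    weightPolymerActivity w (vortexSheet L i j hij) X = weightPolymerActivity w ∅ X := by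
  rw [← sheetAt_zero_zero hij]
  exact weightPolymerActivity_sheetAt_eq_of_card_lt hw hε hij 0 0 hX

end WeightTwistLocality

end Tomboulis2007

end Literature.MathematicalPhysics.QuantumFieldTheory

end
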